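import Summits.QuantumFields.YangMills.Theorems.LuscherReductionRunningReductionTreeGauge
import Summits.QuantumFields.YangMills.Theorems.LuscherReductionTwistedTraceScalingElectricSplit
import HarnessLib

/-!
# Poincaré inequality on the comb spanning tree of `(ℤ/L)³`: `Σ_x ‖η(x) − η(0)‖² ≤ 9L⁴ · Σ_{tree edges} ‖η(∂⁺e) − η(∂⁻e)‖²`
# (layer (B2), item (a) «coercivity on the anchor slice», of the DIRECT Laplace road to ⟨stmt-QuantumFields-24204⟩ `VirialFluxGap.SharpTwistedLaplace`)

Helper module (free-hands work of width seat ym-line-sfw-p2-w2 g50, cell ym-idea-1; `--supports 24204`).  In the tree gauge of slice `0`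
(✓`VirialFluxGapRingTreeGauge`) the gauge modes `ξ` of ✓`exists_skew_linearised_le_sqrt_ringDeficit` (Cor B) that are NOT constant are seen by the
tree links of slice `0`, where the chart coordinate vanishes and the linearised gauge mode is the discrete gradient `ξ(x) − ξ(x + ê_k)`; the
angle lemma of item (a) therefore needs a Poincaré inequality on the comb tree ✓`FemtoTransferGap.treeEdge` (rooted at `0`; legs along
directions `0`, `1`, `2`, each of `< L` steps):
* `leg_telescope`, `norm_leg_le` — along one leg `y, y + ê_k, …, y + n ê_k` (`n ≤ L`, all its links tree links) the increment `η(y + nê_k) − η(y)`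
  telescopes and `‖η(y + nê_k) − η(y)‖ ≤ √L · √T`, `T = Σ_{tree e} ‖η(∂⁺e) − η(∂⁻e)‖²` (Cauchy–Schwarz; the leg's links are distinct tree links);
* ★ `norm_sub_root_le` — `‖η(x) − η(0)‖ ≤ 3√L·√T` (three legs: ✓`base1`, ✓`base2`, ✓`treeEdge_zero/one/two`);
* ★★ `comb_poincare` — `Σ_x ‖η(x) − η(0)‖² ≤ 9L⁴ · T` for every `η : Site 3 L → V`, `V` any real normed group.
Everything here is PROVED; no definitions, no named facts (namespace `Summit.QuantumFields.YangMills.Theorems.VirialFluxGap.CombTree`).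

HONEST FRAMING: lattice bookkeeping; ⟨24204⟩, ⟨24319⟩, ⟨22884⟩ and every rung stay OPEN; the Yang–Mills mass gap (Clay) is NOT touched; no summit is
proved by a line.

## References
* E. Seiler, *Gauge Theories as a Problem of Constructive QFT…*, LNP 159 (1982), §2 (axial ∕ tree gauges). [SeilerLNP1982]
-/

set_option autoImplicit false

noncomputable section

open scoped BigOperators
open Finset
open Literature.MathematicalPhysics.QuantumFieldTheory
open Literature.MathematicalPhysics.QuantumLattice
open Summit.QuantumFields.YangMills.Theorems.FemtoTransferGap

namespace Summit.QuantumFields.YangMills.Theorems.VirialFluxGap.CombTree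

variable {L : ℕ} [NeZero L] {V : Type*} [NormedAddCommGroup V]

/-! ## §1 One leg of the comb -/

omit [NeZero L] in
/-- The next site of a leg: `(y + j ê_k) + ê_k = y + (j+1) ê_k`. [folklore] -/
theorem shift_leg (y : Site 3 L) (k : Fin 3) (j : ℕ) :
    (y + Pi.single k ((j : ℕ) : ZMod L)).shift k = y + Pi.single k (((j + 1 : ℕ) : ℕ) : ZMod L) := by
  rw [Site.shift, add_assoc, ← Pi.single_add]
  push_cast
  rfl

omit [NeZero L] in
/-- Telescoping along a leg. [folklore] -/
theorem leg_telescope (η : Site 3 L → V) (y : Site 3 L) (k : Fin 3) (n : ℕ) :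
    η (y + Pi.single k ((n : ℕ) : ZMod L)) - η y =
      ∑ j ∈ range n, (η ((y + Pi.single k ((j : ℕ) : ZMod L)).shift k) - η (y + Pi.single k ((j : ℕ) : ZMod L))) := by
  have h := Finset.sum_range_sub (fun j : ℕ => η (y + Pi.single k ((j : ℕ) : ZMod L))) n
  simp only [Nat.cast_zero, Pi.single_zero, add_zero] at h
  rw [← h]
  refine Finset.sum_congr rfl fun j _ => ?_
  rw [shift_leg]

omit [NeZero L] in
/-- The links of a leg of length `n ≤ L` are pairwise distinct. [folklore] -/
theorem leg_injOn (y : Site 3 L) (k : Fin 3) {n : ℕ} (hn : n ≤ L) :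
    Set.InjOn (fun j : ℕ => ((y + Pi.single k ((j : ℕ) : ZMod L), k) : Edge 3 L)) ↑(range n) := by
  intro j hj j' hj' h
  have hj : j < L := lt_of_lt_of_le (Finset.mem_range.mp hj) hn
  have hj' : j' < L := lt_of_lt_of_le (Finset.mem_range.mp hj') hn
  have h1 := congrArg (fun e : Edge 3 L => e.1 k) h
  simp only [Pi.add_apply, Pi.single_eq_same, add_right_inj] at h1
  have h2 := congrArg ZMod.val h1
  rwa [ZMod.val_natCast, ZMod.val_natCast, Nat.mod_eq_of_lt hj, Nat.mod_eq_of_lt hj'] at h2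

/-- ★ One leg: if the `n ≤ L` links `(y + jê_k, k)`, `j < n`, are tree links then `‖η(y + nê_k) − η(y)‖ ≤ √L·√T`. [folklore] -/
theorem norm_leg_le (η : Site 3 L → V) (y : Site 3 L) (k : Fin 3) {n : ℕ} (hn : n ≤ L)
    (htree : ∀ j < n, treeEdge ((y + Pi.single k ((j : ℕ) : ZMod L), k) : Edge 3 L) = true) :
    ‖η (y + Pi.single k ((n : ℕ) : ZMod L)) - η y‖ ≤
      Real.sqrt L * Real.sqrt (∑ e : Edge 3 L, if treeEdge e = true then ‖η (e.1.shift e.2) - η e.1‖ ^ 2 else 0) := by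
  set T : ℝ := ∑ e : Edge 3 L, if treeEdge e = true then ‖η (e.1.shift e.2) - η e.1‖ ^ 2 else 0 with hT
  set F : Edge 3 L → ℝ := fun e => if treeEdge e = true then ‖η (e.1.shift e.2) - η e.1‖ ^ 2 else 0 with hF
  set d : ℕ → ℝ := fun j => ‖η ((y + Pi.single k ((j : ℕ) : ZMod L)).shift k) - η (y + Pi.single k ((j : ℕ) : ZMod L))‖ with hd
  have hF0 : ∀ e, 0 ≤ F e := fun e => by simp only [hF]; split_ifs <;> positivity
  -- the leg's squared increments are among the tree terms
  have hsub : ∑ j ∈ range n, d j ^ 2 ≤ T := by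
    have e1 : ∑ j ∈ range n, d j ^ 2 = ∑ j ∈ range n, F ((y + Pi.single k ((j : ℕ) : ZMod L), k) : Edge 3 L) := by
      refine Finset.sum_congr rfl fun j hj => ?_
      simp only [hF, hd, htree j (Finset.mem_range.mp hj), if_true]
    rw [e1, ← Finset.sum_image (leg_injOn y k hn)]
    exact Finset.sum_le_sum_of_subset_of_nonneg (Finset.subset_univ _) fun e _ _ => hF0 e
  -- Cauchy–Schwarz on the leg
  have hcs : (∑ j ∈ range n, d j) ^ 2 ≤ n * ∑ j ∈ range n, d j ^ 2 := by
    have h := Finset.sum_mul_sq_le_sq_mul_sq (range n) (fun _ => (1 : ℝ)) d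
    simp only [one_mul, one_pow, Finset.sum_const, Finset.card_range, nsmul_eq_mul, mul_one] at h
    exact h
  have hnL : (n : ℝ) ≤ L := by exact_mod_cast hn
  have hd0 : 0 ≤ ∑ j ∈ range n, d j := Finset.sum_nonneg fun j _ => norm_nonneg _
  calc ‖η (y + Pi.single k ((n : ℕ) : ZMod L)) - η y‖
      = ‖∑ j ∈ range n, (η ((y + Pi.single k ((j : ℕ) : ZMod L)).shift k) - η (y + Pi.single k ((j : ℕ) : ZMod L)))‖ := by
        rw [leg_telescope]
    _ ≤ ∑ j ∈ range n, d j := norm_sum_le _ _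
    _ ≤ Real.sqrt (L * T) := by
        apply Real.le_sqrt_of_sq_le
        calc (∑ j ∈ range n, d j) ^ 2 ≤ n * ∑ j ∈ range n, d j ^ 2 := hcs
          _ ≤ L * T := mul_le_mul hnL hsub (Finset.sum_nonneg fun j _ => sq_nonneg _) (Nat.cast_nonneg L)
    _ = Real.sqrt L * Real.sqrt T := Real.sqrt_mul (Nat.cast_nonneg L) T

/-! ## §2 The three legs of the comb path from `0` to `x` -/

/-- ★ **Tree-path bound**: `‖η(x) − η(0)‖ ≤ 3√L·√T` for every site `x`. [folklore] -/
theorem norm_sub_root_le (η : Site 3 L → V) (x : Site 3 L) :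
    ‖η x - η 0‖ ≤ 3 * (Real.sqrt L * Real.sqrt (∑ e : Edge 3 L, if treeEdge e = true then ‖η (e.1.shift e.2) - η e.1‖ ^ 2 else 0)) := by
  set R : ℝ := Real.sqrt L * Real.sqrt (∑ e : Edge 3 L, if treeEdge e = true then ‖η (e.1.shift e.2) - η e.1‖ ^ 2 else 0) with hR
  have hval : ∀ k : Fin 3, (x k).val ≤ L := fun k => (ZMod.val_lt (x k)).le
  -- leg 0: from `0` to `base1 x`
  have h0 : ‖η (base1 x) - η 0‖ ≤ R := by
    have h := norm_leg_le η (0 : Site 3 L) 0 (hval 0) (fun j hj => treeEdge_zero hj)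
    rwa [natCast_val_eq, zero_add_single] at h
  -- leg 1: from `base1 x` to `base2 x`
  have h1 : ‖η (base2 x) - η (base1 x)‖ ≤ R := by
    have hy1 : base1 x 1 = 0 := by rw [base1_apply]; simp
    have hy2 : base1 x 2 = 0 := by rw [base1_apply]; simp
    have h := norm_leg_le η (base1 x) 1 (hval 1) (fun j hj => treeEdge_one hy1 hy2 hj)
    rwa [natCast_val_eq, base1_add_single] at h
  -- leg 2: from `base2 x` to `x`
  have h2 : ‖η x - η (base2 x)‖ ≤ R := by
    have hy2 : base2 x 2 = 0 := by rw [base2_apply]; simp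
    have h := norm_leg_le η (base2 x) 2 (hval 2) (fun j hj => treeEdge_two hy2 hj)
    rwa [natCast_val_eq, base2_add_single] at h
  calc ‖η x - η 0‖ = ‖(η x - η (base2 x)) + (η (base2 x) - η (base1 x)) + (η (base1 x) - η 0)‖ := by abel_nf
    _ ≤ ‖η x - η (base2 x)‖ + ‖η (base2 x) - η (base1 x)‖ + ‖η (base1 x) - η 0‖ := norm_add₃_le
    _ ≤ 3 * R := by linarith

/-! ## §3 The Poincaré inequality -/

/-- ★★ **Poincaré inequality on the comb tree**: `Σ_x ‖η(x) − η(0)‖² ≤ 9L⁴ · Σ_{tree e} ‖η(∂⁺e) − η(∂⁻e)‖²`. [cite: SeilerLNP1982, §2] -/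
theorem comb_poincare (η : Site 3 L → V) :
    ∑ x : Site 3 L, ‖η x - η 0‖ ^ 2 ≤
      9 * (L : ℝ) ^ 4 * ∑ e : Edge 3 L, (if treeEdge e = true then ‖η (e.1.shift e.2) - η e.1‖ ^ 2 else 0) := by
  set T : ℝ := ∑ e : Edge 3 L, if treeEdge e = true then ‖η (e.1.shift e.2) - η e.1‖ ^ 2 else 0 with hT
  have hT0 : 0 ≤ T := Finset.sum_nonneg fun e _ => by split_ifs <;> positivity
  have hL0 : (0 : ℝ) ≤ L := Nat.cast_nonneg L
  have hpt : ∀ x : Site 3 L, ‖η x - η 0‖ ^ 2 ≤ 9 * L * T := by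
    intro x
    have h := norm_sub_root_le η x
    have h0 : 0 ≤ 3 * (Real.sqrt L * Real.sqrt T) := by positivity
    calc ‖η x - η 0‖ ^ 2 ≤ (3 * (Real.sqrt L * Real.sqrt T)) ^ 2 := pow_le_pow_left₀ (norm_nonneg _) h 2
      _ = 9 * L * T := by
          rw [mul_pow, mul_pow, Real.sq_sqrt hL0, Real.sq_sqrt hT0]; ring
  calc ∑ x : Site 3 L, ‖η x - η 0‖ ^ 2 ≤ ∑ _x : Site 3 L, 9 * L * T := Finset.sum_le_sum fun x _ => hpt x
    _ = (L : ℝ) ^ 3 * (9 * L * T) := by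
        rw [Finset.sum_const, Finset.card_univ, FemtoTransferGap.TwoLattice.Electric.card_site, nsmul_eq_mul, Nat.cast_pow]
    _ = 9 * (L : ℝ) ^ 4 * T := by ring

end Summit.QuantumFields.YangMills.Theorems.VirialFluxGap.CombTree
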